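/-
Origin: expansion seat `planner-pub-hodgecm-mc-axioms-1-g14-0`, handover #W201 2026-08-20T15:53:55Z md5 e82c23af0e42 (PKG a5cce3e800a0 → e82c23af0e42; 114 l.; MECHANICAL (iib-R) rewrite v3.1 of the PKG file as it stands (4 token edits; rules R1x1+RX[h₂]x3)) (`HOME/mc/pub-hodgecm-mc-axioms-1-g14/revendor/kit-r55/stage55/HodgeCM/Model/Binders/Real34CensusR2Pin.lean`, md5 e82c23af0e42, 114 lines);
landed by the gen-22 packager (p-g22) in gate run 55 REPLACES the earlier landed copy of `HodgeCM/Model/Binders/Real34CensusR2Pin.lean` (seat copy carried the packager Origin header of an earlier run (stripped)).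
-/
/-
Origin: speedrun cell pub-hodgecm, MODEL-CONSTRUCTION sub-cell, unit pub-hodgecm-mc-binder-1-g13 (BINDER PROVER, gen 13; ROW 17's census-T record AT E's R2-J PIN
FROM THE GUARD ALONE), seat prover-pub-hodgecm-mc-binder-1-g13-0, 2026-08-20.  Target in PKG: HodgeCM/Model/Binders/Real34CensusR2Pin.lean (NEW additive leaf;
imports `Binders/Real34CensusSigmaP2` (#R81), carch #CA59 `Model/ArchKTypeOfLineSupplyPin`, binder-2 #S12 `HypCensus/KappaJoin`, theta-3 (K14)
`Model/ArchPinWeightDischarge34`, sinst #1229 `Model/ThetaAdelicSideR2`).  KERNEL ONLY: 1 def-valued constructor; 0 records of published theorems,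
nothing cited, 0 `def … : Prop`, MODEL-N ±0, E unchanged.  Nothing here is a claim of the manuscripts under adjudication.
-/
import Summits.HodgeConjecture.HodgeCM.Model.Binders.Real34CensusSigmaP2
import Summits.HodgeConjecture.HodgeCM.Model.ArchKTypeOfLineSupplyPin
import Summits.HodgeConjecture.HodgeCM.Model.HypCensus.KappaJoin
import Summits.HodgeConjecture.HodgeCM.Model.ArchPinWeightDischarge34
import Summits.HodgeConjecture.HodgeCM.Model.ThetaAdelicSideR2
import Summits.HodgeConjecture.HodgeCM.Model.Binders.Real34PinsROG



set_option autoImplicit false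

noncomputable section

open MeasureTheory NumberField

namespace HodgeCM.Model

open HodgeCM HodgeCM.Universe HodgeCM.Adelic
open Literature.NumberTheory.Weil1964
open Literature.NumberTheory.Automorphic (piSchwartzBruhat archWeight)
open Literature.NumberTheory.GelbartRogawski1991.UnitaryDualPair
open Literature.AlgebraicGeometry.HodgeTheory
open Literature.NumberTheory.Automorphic.PicardCM
open Literature.NumberTheory.Transcendental (Arapura2012_Cor_15_4_6)
open HodgeCM.CMTypeOps (inflate)
open HodgeCM.Model.ThetaSpace
open HodgeCM.Model.ArchSideTerm


/-!
# Row 17's (34) census-T record at E's R2-J pin `SROGT'CJ`, from the OG guard alone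

**`Gen12PinsP2.censusT_R2CJ_of_GOG (jD) (hg : SInstance.GOG V c) (hV) (hW)`** : the P2 record `Gen12PinsP2.Real34CensusSideT` at the pin
`SROGT'CJ @hGR @hGR₀..₃ @μ = SGPT' @GOG @hG_GOG @hGR η♯♯ … (ART' … μ♯♯ …)` (`η♯♯ := EtaChi.η χVR (χWR μ♯♯)`, `μ♯♯ := muSharp₂₃ μ`), i.e. the `CT`
group of glue-1's #398J2HHT, with EVERY input of the σ₃₄ socket `ofCensus34` (#R81) supplied at the pin:
`hκ` := binder-2 `hκ_of_hasArchType_pairType` ∘ `hasArchType_χVR_pairType` ((V-val), `hposW_of_goodCtx_orientBitι`);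
`hμ₃₄` := theta-3 (K14) `ArchSideTerm.hμ₃₄_GOG` ((J-μ)₃₄ at `swapPin`); `hpos₂ hpos₃` := `SInstance.hpos_GOG`; `hLF₂ hLF₃` := sinst `hLF_ROGT'CJ`;
`hsupply` := carch #CA59 `SInstance.hsupply_two_three_ROGT'CJ`.  Left as inputs: the census index datum `jD` (data, any value), the regime facts
`hV : IsAnisotropic L V.Hm`, `hW : IsAnisotropic L c.D.gramW` (both read off a good context at E level).  With #R73 `real34_R2CET` this makes E's
`real34` group at the R2-J pins a consequence of E's own rows (`h31`, `hLiu`) — row 17 has no residual family left at that pin.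
-/

namespace Gen12PinsP2

variable
  (hGR : ∀ {L : CMField} {ι₁ : L →+* ℂ} (V : HermSpace3 L ι₁) (c : SeesawCtx L),
    (cmSplittingDatum (L : Type) finProdFinEquiv (frameD V) (frameD_real V) (frameD_ne V) (dW c.D) (dW_real c.D)
      (dW_ne c.D)).CompatibleSplitting)
  (hGR₀ : ∀ {L : CMField} {ι₁ : L →+* ℂ} (V : HermSpace3 L ι₁) (c : SeesawCtx L),
    (cmSplittingDatum (L : Type) (e₁) (frameD V) (frameD_real V) (frameD_ne V) (lineVec (L : Type) (dW c.D 0))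
      (fun _ => dW_real c.D 0) (fun _ => dW_ne c.D 0)).CompatibleSplitting)
  (hGR₁ : ∀ {L : CMField} {ι₁ : L →+* ℂ} (V : HermSpace3 L ι₁) (c : SeesawCtx L),
    (cmSplittingDatum (L : Type) (e₁) (frameD V) (frameD_real V) (frameD_ne V) (lineVec (L : Type) (dW c.D 1))
      (fun _ => dW_real c.D 1) (fun _ => dW_ne c.D 1)).CompatibleSplitting)
  (hGR₂ : ∀ {L : CMField} {ι₁ : L →+* ℂ} (V : HermSpace3 L ι₁) (c : SeesawCtx L),
    (cmSplittingDatum (L : Type) (e₁) (frameD V) (frameD_real V) (frameD_ne V) (lineVec (L : Type) (dW' c.D 0))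
      (fun _ => dW'_real c.D 0) (fun _ => dW'_ne c.D 0)).CompatibleSplitting)
  (hGR₃ : ∀ {L : CMField} {ι₁ : L →+* ℂ} (V : HermSpace3 L ι₁) (c : SeesawCtx L),
    (cmSplittingDatum (L : Type) (e₁) (frameD V) (frameD_real V) (frameD_ne V) (lineVec (L : Type) (dW' c.D 1))
      (fun _ => dW'_real c.D 1) (fun _ => dW'_ne c.D 1)).CompatibleSplitting)
  (μ : ∀ {L : CMField}, SeesawCtx L → Fin 4 → NumberField.InfinitePlace (L : Type) → ℤ)

variable (hHD : exists_isReal_hodgeModel) (hI : hodgePQ_independent_of_hodgeModel)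
  (h₁ : BallQuotientUniformised)  (h₃ : CMAbelianVarietyRealised)
  (h : Bool) (hA : Arapura2012_Cor_15_4_6)

section Pointwise

variable {L : CMField} {ι₁ : L →+* ℂ} (V : HermSpace3 L ι₁) (c : SeesawCtx L)

/-- **ROW 17's (34) CENSUS-T RECORD AT E's R2-J PIN FROM THE GUARD** — `ofCensus34` with `hκ`, `hμ₃₄`, `hpos`, `hLF`, `hsupply` all supplied
at `SROGT'CJ @hGR @hGR₀..₃ @μ`; inputs: the index datum `jD` and the two regime facts. -/
def censusT_R2CJ_of_GOG (jD : NumberField.InfinitePlace (L : Type) → HodgeCM.PerL34.Fock.EqVar → Fin 6)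
    (hg : SInstance.GOG V c) (hV : IsAnisotropic L V.Hm) (hW : IsAnisotropic L c.D.gramW) :
    Real34CensusSideT @SInstance.GOG @SInstance.hG_GOG @hGR
      (@EtaChi.η (@SInstance.χVR @hGR @hGR₀ @hGR₁) (@SInstance.χWR @hGR @hGR₀ @hGR₁ (ArchSideTerm.muSharp₂₃ @μ)))
      (@EtaChi.hη (@SInstance.χVR @hGR @hGR₀ @hGR₁) (@SInstance.χWR @hGR @hGR₀ @hGR₁ (ArchSideTerm.muSharp₂₃ @μ)))
      (@EtaChi.hηc (@SInstance.χVR @hGR @hGR₀ @hGR₁) (@SInstance.χWR @hGR @hGR₀ @hGR₁ (ArchSideTerm.muSharp₂₃ @μ)))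
      (@SInstance.νR @hGR₁) (@SInstance.hνR @hGR₁) (@SInstance.hνcR @hGR₁) (@SInstance.ν'R @hGR₃) (@SInstance.hν'R @hGR₃) (@SInstance.hν'cR @hGR₃)
      @hGR₀ @hGR₁ @hGR₂ @hGR₃
      (@SInstance.ART' @SInstance.GOG @SInstance.hG_GOG @hGR (@SInstance.χVR @hGR @hGR₀ @hGR₁) (@SInstance.νR @hGR₁) (@SInstance.ν'R @hGR₃)
        @hGR₀ @hGR₁ @hGR₂ @hGR₃ (ArchSideTerm.muSharp₂₃ @μ) @SInstance.hpos_GOG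
        (ArchSideTerm.hΔ₁_GOG_muSharp₂₃ @hGR @hGR₀ @hGR₁ @hGR₂ @hGR₃ @μ)
        (ArchSideTerm.hΔ₂_GOG_muSharp₂₃_holds @hGR @hGR₀ @hGR₁ @hGR₂ @hGR₃ @μ)
        (ArchSideTerm.hΔ₃_GOG_muSharp₂₃_holds @hGR @hGR₀ @hGR₁ @hGR₂ @hGR₃ @μ))
      hHD hI h₁ h₃ h hA (ArchSideTerm.muSharp₂₃ @μ) V c hV :=
  Real34CensusSideT.ofCensus34 _ _ _ _ _ _ _ _ _ _ _ _ _ _ _ _ _ hHD hI h₁ h₃ h hA _ V c hV hW (SInstance.hG_GOG V c hg) jD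
    (HypCensus.hκ_of_hasArchType_pairType V c.D (hGR V c) (SInstance.hG_GOG V c hg)
      ((@SInstance.χVR @hGR @hGR₀ @hGR₁) V c) ((@SInstance.χWR @hGR @hGR₀ @hGR₁ (ArchSideTerm.muSharp₂₃ @μ)) V c)
      (HypCensus.hposW_of_goodCtx_orientBitι V hg.2 hg.1) hg.1
      (HypCensus.hasArchType_χVR_pairType @hGR @hGR₀ @hGR₁ V c hg (SInstance.hG_GOG V c hg) (HypCensus.hposW_of_goodCtx_orientBitι V hg.2 hg.1)))
    (fun t => ArchSideTerm.hμ₃₄_GOG hGR (@SInstance.χVR @hGR @hGR₀ @hGR₁) hGR₀ hGR₁ hGR₂ hGR₃ μ V c hg (SInstance.hG_GOG V c hg) _ t)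
    (SInstance.hpos_GOG V c hg).2.2.1 (SInstance.hpos_GOG V c hg).2.2.2
    (SInstance.hLF_ROGT'CJ @hGR @hGR₀ @hGR₁ @hGR₂ @hGR₃ @μ V c 2) (SInstance.hLF_ROGT'CJ @hGR @hGR₀ @hGR₁ @hGR₂ @hGR₃ @μ V c 3)
    (SInstance.hsupply_two_three_ROGT'CJ hHD hI h₁ h₃ @hGR @hGR₀ @hGR₁ @hGR₂ @hGR₃ @μ V c hg hV)

end Pointwise

end Gen12PinsP2

end HodgeCM.Model

end
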